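/-
Copyright (c) 2026 the pub-hodgecm-mathlib formalisation cell (harness21).  Prover seat hodgecm-mathlib-LH4-p12 (g0): MS ROAD-A brick «𝓛₀ IS FINITE» dealt BY SIGNATURE by
LH4-p10 (g0) (MEMO-stableLaw-finite v1 §2∕§7, dealer LH4-plan (g10) WORD #38 (2)).  2026-09-03.
-/
import Literature.NumberTheory.Automorphic.UnitaryLatticeTreeIntervalFinite   -- ★ (F0P3-p03): `finite_setOf_scaleLattice_le_and_le` (lattice intervals are finite); brings `latt`, `mapGL`, `scaleLattice`, `stdLattice`
import HarnessLib

/-!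
# Crux `H413`, line LH4 «(D-RAM) FOUR-FRAME» road — MS ROAD A («(S-fin)», LH4-p10 (g0)): the NORMALISED lattices stable under a regular unit diagonal torus element
# form a FINITE set (`𝓛₀` is finite)

Cell `hodgecm-mathlib` (D-0151), FLOOR 0, crux item H413 = `stmt-HodgeConjecture-24833`, route of record `HCCMUnconditional`; squad F0∕P3c∕LH4 (req620 Track A), unit U3
(the stable four-frame law (S), `stub_U3_stableLaw_RP ∕ _RU`), LH4-p10 (g0)'s finite-ring reduction «(S-fin)» (MEMO-stableLaw-finite v1): (S) ⟺ a weighted count over the set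
`𝓛₀` of NORMALISED `γ`-stable lattices of the diagonal model `γ = diag(s)`.  This file is the brick «𝓛₀ IS FINITE» (signature dealt by p10, 2026-09-03T22:29Z).  THEOREMS ONLY
(no `def`, no instance, no notation, no `sorry`, default heartbeats); imports ★ only; lane `--supports stmt-HodgeConjecture-24833` (count-neutral).

WHAT IS PROVED.  `finite_setOf_normalised_diagonal_fixed_latt`: over a `ℤᵐ⁰`-valued field `K` with a uniformiser `ϖ` and FINITE residue field, for a diagonal `T = diag(s)` with
pairwise distinct UNIT entries `s_i`, the set of `𝒪`-lattices `M = latt g` with `T·M = M` which are NORMALISED (`M ≤ 𝒪³` and every coordinate projection of `M` contains a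
unit) is finite.  PROOF (Lagrange interpolation on the `T`-stable `𝒪`-module): for `x ∈ M`, `T x`, `T² x ∈ M`, so `(T − s_j)(T − s_k)·x = μ_i x_i e_i ∈ M` with
`μ_i = (s_i − s_j)(s_i − s_k) ≠ 0` (`{i, j, k} = {0, 1, 2}`); taking `x` with `x_i` a unit gives `μ_i e_i ∈ M`; hence `a·𝒪³ ≤ M ≤ 𝒪³` for `a = μ₀μ₁μ₂ ≠ 0`, and the lattice
interval `[a·𝒪³, 𝒪³]` is finite (★ `finite_setOf_scaleLattice_le_and_le`).  The `latt`-clause of the set is not used (every `𝒪`-submodule in the interval is counted).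

HONEST LABEL.  Count-neutral; a brick of p10's (S-fin) road, which re-lines the OPEN U3 stubs `stub_U3_stableLaw_RP ∕ _RU`; the verdict of record for (D-RAM) stays PRINT
[LanglandsShelstad1989 Thm. p. 484 ∕ Rogawski1990 Prop. 4.9.1 (a)] ∕ XL; `HC_CM` is proved only modulo the 7 printed citations (2 remaining: hLiu418 = `stmt-HodgeConjecture-24832`,
h413 = `stmt-HodgeConjecture-24833`) until rung 0 closes.

## References
* [Serre1980Trees] J.-P. Serre, *Trees* (1980), Ch. II §1.1 (lattices in `K^n` over a discretely valued field; finiteness between two commensurable lattices).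
* [Kottwitz1986BaseChangeUnits] R. E. Kottwitz, *Base change for unit elements of Hecke algebras*, Compositio Math. 60 (1986), §1 pp. 240–241 (lattices fixed by a regular
  semisimple element lie in a bounded interval around its eigen-lattice).
-/

set_option autoImplicit false

noncomputable section

namespace Summit.HodgeConjecture.HodgeConjecture.Cruxes.H413.F0P3cDyRamDiagonalStableLatticesFinite

open scoped Valued WithZero Matrix MatrixGroups
open Literature.NumberTheory.Automorphic Literature.NumberTheory.Automorphic.UnitaryLatticeTree Literature.NumberTheory.Automorphic.HermitianLattice

/-- **`𝓛₀` IS FINITE**: for `T = diag(s)` with pairwise distinct unit entries over a `ℤᵐ⁰`-valued field with uniformiser `ϖ` and finite residue field, the `T`-stable lattices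
`M = latt g` that are normalised (`|x_i| ≤ 1` on `M`, with equality attained, for every `i`) form a finite set — Lagrange interpolation gives `μ_i e_i ∈ M`,
`μ_i = ∏_{j ≠ i}(s_i − s_j) ≠ 0`, so `μ₀μ₁μ₂·𝒪³ ≤ M ≤ 𝒪³`, a finite lattice interval. [cite: Serre1980Trees, II.1.1] [cite: Kottwitz1986BaseChangeUnits, §1 pp. 240–241] -/
theorem finite_setOf_normalised_diagonal_fixed_latt {K : Type*} [Field K] [Valued K ℤᵐ⁰] [Finite 𝓀[K]] {ϖ : K}
    (hϖ : Valued.v ϖ = WithZero.exp (-1 : ℤ)) (s : Fin 3 → K) (hs : ∀ i, Valued.v (s i) = 1) (hreg : ∀ i j, i ≠ j → s i ≠ s j)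
    (T : GL (Fin 3) K) (hT : (T : Matrix (Fin 3) (Fin 3) K) = Matrix.diagonal s) :
    {M : Submodule 𝒪[K] (Fin 3 → K) | (∃ g : GL (Fin 3) K, M = latt (g : Matrix (Fin 3) (Fin 3) K)) ∧ mapGL T M = M ∧
      ∀ i, (∀ x ∈ M, Valued.v (x i) ≤ 1) ∧ ∃ x ∈ M, Valued.v (x i) = 1}.Finite := by
  -- pairwise differences of the eigenvalues are non-zero integers
  have hd0 : ∀ i j : Fin 3, i ≠ j → s i - s j ≠ 0 := fun i j h => sub_ne_zero.2 (hreg i j h)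
  have hd1 : ∀ i j : Fin 3, Valued.v (s i - s j) ≤ 1 := fun i j =>
    (Valuation.map_sub _ _ _).trans (max_le (hs i).le (hs j).le)
  -- the Lagrange multipliers `μ_i = ∏_{j ≠ i} (s_i − s_j)` and their product `a`
  have hμ0 : ∀ i : Fin 3, (![(s 0 - s 1) * (s 0 - s 2), (s 1 - s 0) * (s 1 - s 2), (s 2 - s 0) * (s 2 - s 1)] : Fin 3 → K) i ≠ 0 := by
    intro i
    fin_cases i
    · exact mul_ne_zero (hd0 0 1 (by decide)) (hd0 0 2 (by decide))
    · exact mul_ne_zero (hd0 1 0 (by decide)) (hd0 1 2 (by decide))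
    · exact mul_ne_zero (hd0 2 0 (by decide)) (hd0 2 1 (by decide))
  have hμ1 : ∀ i : Fin 3, Valued.v ((![(s 0 - s 1) * (s 0 - s 2), (s 1 - s 0) * (s 1 - s 2), (s 2 - s 0) * (s 2 - s 1)] : Fin 3 → K) i) ≤ 1 := by
    intro i
    fin_cases i
    · show Valued.v ((s 0 - s 1) * (s 0 - s 2)) ≤ 1
      rw [map_mul]; exact mul_le_one' (hd1 0 1) (hd1 0 2)
    · show Valued.v ((s 1 - s 0) * (s 1 - s 2)) ≤ 1
      rw [map_mul]; exact mul_le_one' (hd1 1 0) (hd1 1 2)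
    · show Valued.v ((s 2 - s 0) * (s 2 - s 1)) ≤ 1
      rw [map_mul]; exact mul_le_one' (hd1 2 0) (hd1 2 1)
  set μ : Fin 3 → K := ![(s 0 - s 1) * (s 0 - s 2), (s 1 - s 0) * (s 1 - s 2), (s 2 - s 0) * (s 2 - s 1)] with hμ_def
  set a : K := μ 0 * μ 1 * μ 2 with ha_def
  have ha0 : a ≠ 0 := mul_ne_zero (mul_ne_zero (hμ0 0) (hμ0 1)) (hμ0 2)
  have ha1 : Valued.v a ≤ 1 := by
    rw [ha_def, map_mul, map_mul]; exact mul_le_one' (mul_le_one' (hμ1 0) (hμ1 1)) (hμ1 2)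
  have haμ : ∀ i : Fin 3, Valued.v a ≤ Valued.v (μ i) := by
    intro i
    fin_cases i
    · show Valued.v a ≤ Valued.v (μ 0)
      rw [ha_def, mul_assoc, map_mul]
      exact mul_le_of_le_one_right' (by rw [map_mul]; exact mul_le_one' (hμ1 1) (hμ1 2))
    · show Valued.v a ≤ Valued.v (μ 1)
      rw [ha_def, mul_comm (μ 0) (μ 1), mul_assoc, map_mul]
      exact mul_le_of_le_one_right' (by rw [map_mul]; exact mul_le_one' (hμ1 0) (hμ1 2))
    · show Valued.v a ≤ Valued.v (μ 2)
      rw [ha_def, mul_comm, map_mul]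
      exact mul_le_of_le_one_right' (by rw [map_mul]; exact mul_le_one' (hμ1 0) (hμ1 1))
  -- the whole set lies in the finite lattice interval `[a·𝒪³, 𝒪³]`
  refine (finite_setOf_scaleLattice_le_and_le (N := 3) hϖ ha0 (show Valued.v a ≤ Valued.v (1 : K) by rw [map_one]; exact ha1)).subset ?_
  rintro M ⟨-, hTM, hnorm⟩
  -- integral scalars act on `M`
  have hsmul : ∀ c : K, Valued.v c ≤ 1 → ∀ x ∈ M, c • x ∈ M := fun c hc x hx =>
    M.smul_mem (⟨c, (mem_integer_iff' c).2 hc⟩ : 𝒪[K]) hx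
  -- `T` acts on `M`: `x ∈ M ⇒ (l ↦ s_l x_l) ∈ M`
  have hTx : ∀ x ∈ M, (fun l => s l * x l) ∈ M := by
    intro x hx
    have h : ((Matrix.toLin' (T : Matrix (Fin 3) (Fin 3) K)).restrictScalars 𝒪[K]) x ∈ mapGL T M := Submodule.mem_map_of_mem hx
    rw [hTM] at h
    have heq : ((Matrix.toLin' (T : Matrix (Fin 3) (Fin 3) K)).restrictScalars 𝒪[K]) x = fun l => s l * x l := by
      ext l
      rw [LinearMap.restrictScalars_apply, Matrix.toLin'_apply, hT, Matrix.mulVec_diagonal]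
    rwa [heq] at h
  -- Lagrange interpolation: `(T − s_j)(T − s_k)·x ∈ M`
  have hlag : ∀ x ∈ M, ∀ j k : Fin 3, (fun l => (s l - s j) * (s l - s k) * x l) ∈ M := by
    intro x hx j k
    have h1 : (fun l => s l * (s l * x l)) ∈ M := hTx _ (hTx x hx)
    have h2 : (s j + s k) • (fun l => s l * x l) ∈ M :=
      hsmul (s j + s k) ((Valuation.map_add _ _ _).trans (max_le (hs j).le (hs k).le)) _ (hTx x hx)
    have h3 : (s j * s k) • x ∈ M := hsmul (s j * s k) (by rw [map_mul, hs, hs, mul_one]) x hx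
    have h := M.add_mem (M.sub_mem h1 h2) h3
    convert h using 1
    ext l
    simp only [Pi.add_apply, Pi.sub_apply, Pi.smul_apply, smul_eq_mul]
    ring
  -- the Lagrange vectors `μ_i e_i ∈ M`
  have pig : ∀ i j k l : Fin 3, j ≠ i → k ≠ i → j ≠ k → l ≠ i → l = j ∨ l = k := by decide
  have key : ∀ (i j k : Fin 3) (x : Fin 3 → K), x i ≠ 0 → j ≠ i → k ≠ i → j ≠ k →
      (Pi.single i ((s i - s j) * (s i - s k)) : Fin 3 → K) = (x i)⁻¹ • (fun l => (s l - s j) * (s l - s k) * x l) := by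
    intro i j k x hx hji hki hjk
    ext l
    rw [Pi.smul_apply, smul_eq_mul]
    by_cases hl : l = i
    · rw [hl, Pi.single_eq_same, eq_inv_mul_iff_mul_eq₀ hx]
      ring
    · rw [Pi.single_eq_of_ne hl]
      rcases pig i j k l hji hki hjk hl with rfl | rfl <;> simp
  -- for each slot `i`, the two other slots `(J i, K′ i)`
  have hJ : ∀ i : Fin 3, (![1, 0, 0] : Fin 3 → Fin 3) i ≠ i := by decide
  have hK : ∀ i : Fin 3, (![2, 2, 1] : Fin 3 → Fin 3) i ≠ i := by decide
  have hJK : ∀ i : Fin 3, (![1, 0, 0] : Fin 3 → Fin 3) i ≠ (![2, 2, 1] : Fin 3 → Fin 3) i := by decide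
  have hμJK : ∀ i : Fin 3, μ i = (s i - s ((![1, 0, 0] : Fin 3 → Fin 3) i)) * (s i - s ((![2, 2, 1] : Fin 3 → Fin 3) i)) := by
    intro i; fin_cases i <;> rfl
  have hsingle : ∀ i : Fin 3, (Pi.single i (μ i) : Fin 3 → K) ∈ M := by
    intro i
    obtain ⟨x, hxM, hxi⟩ := (hnorm i).2
    have hxi0 : x i ≠ 0 := fun h0 => by rw [h0, map_zero] at hxi; exact zero_ne_one hxi
    have hxinv : Valued.v (x i)⁻¹ ≤ 1 := by rw [map_inv₀, hxi, inv_one]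
    rw [hμJK i, key i _ _ x hxi0 (hJ i) (hK i) (hJK i)]
    exact hsmul _ hxinv _ (hlag x hxM _ _)
  constructor
  · -- `a · 𝒪³ ≤ M`
    intro z hz
    have hz' := (mem_scaleLattice_stdLattice_iff ha0 z).1 hz
    have hsum : z = ∑ i : Fin 3, (z i / μ i) • (Pi.single i (μ i) : Fin 3 → K) := by
      ext l
      simp only [Finset.sum_apply, Pi.smul_apply, Pi.single_apply, smul_eq_mul, mul_ite, mul_zero, Finset.sum_ite_eq, Finset.mem_univ,
        if_true]
      rw [div_mul_cancel₀ _ (hμ0 l)]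
    rw [hsum]
    exact M.sum_mem fun i _ =>
      hsmul _ (by rw [map_div₀, div_le_one₀ ((Valuation.pos_iff _).2 (hμ0 i))]; exact (hz' i).trans (haμ i)) _ (hsingle i)
  · -- `M ≤ 𝒪³ = 1 · 𝒪³`
    intro x hx
    exact (mem_scaleLattice_stdLattice_iff one_ne_zero x).2 fun i => by rw [map_one]; exact (hnorm i).1 x hx

end Summit.HodgeConjecture.HodgeConjecture.Cruxes.H413.F0P3cDyRamDiagonalStableLatticesFinite

end
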